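import Mathlib
import Summits.Ventures.PercRepro2.Defs
import Summits.Ventures.PercRepro2.Graph
import Summits.Ventures.PercRepro2.OneColourSwitch
import Summits.Ventures.PercRepro2.RegionHubSign
import Summits.Ventures.PercRepro2.SideSwitch
import Summits.Ventures.PercRepro2.TermSwitchDefs
import Summits.Ventures.PercRepro2.TermSwitchReach
import Summits.Ventures.PercRepro2.M9NoPocketDefs
import Summits.Ventures.PercRepro2.M9GeneralDSplit
import Summits.Ventures.PercRepro2.M9LinkedHD
import Summits.Ventures.PercRepro2.M9HDRSplit
import Summits.Ventures.PercRepro2.M9WorldSwitch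

/-!
# The linking components of the `W`-world (blind cell PercRepro2, p3 g30, 2026-08-28;
`proofs/P3-HDR.md` §4, the set `S` of the switch `ψ`)

`M₂° = M₂ ∖ {r, s}`; two vertices of `M₂°` are **`G`-connected within `M₂°`** when a path of
edges of any colour with all its vertices in `M₂°` joins them (`gconnM`, the configuration
`allM` of the edges inside `M₂°`); the **component** of `y` is `gcomp y`.  The component of `y`
**carries** `r ~ s` when the `W`-edges inside `gcomp y ∪ {r, s}` join `r` to `s` (`compW y`).  The
**linking set** `linkSet` is the union of the carrying components.  Proved: `linkSet` is closed in
the `W`-world (`linkSet_wClosed`), the `W`-edges touching it join `r` to `s`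
(`conn_wIn_linkSet`), and no `W`-path avoiding it does (`not_conn_wOut_linkSet`) — the two
hypotheses of `M9WorldSwitchHD.hdKYOnly_flipTouch_of_wOnly`; the key lemma is the
**path lemma** `exists_carrier_of_conn`: a `W`-connection `r ~ s` without a direct `r–s` edge has
an internal vertex whose component carries it (a closure argument along the connection).  Own
work; std axioms.
-/

namespace Summit.Ventures.PercRepro2

namespace NoPocket

open Finset Classical RegionHub OneColourSwitch SideSwitch TermSwitch

variable {V : Type*} {E : Type*}

section Link

variable (ends : E → Sym2 V) (r s : V) (ω : Config E)

/-- The edges inside `M₂ ∖ {r, s}`, all open. -/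
noncomputable def allM : Config E :=
  fun e => if e ∈ within ends ((M2 ends r s ω) \ {r, s}) then true else false

/-- `G`-connectivity within `M₂ ∖ {r, s}`. -/
def gconnM (x y : V) : Prop := Conn ends (allM ends r s ω) x y

/-- The `G`-component of `y` within `M₂ ∖ {r, s}` (as a set of vertices). -/
def gcomp (y : V) : Set V := {x | gconnM ends r s ω x y}

/-- The `W`-edges inside `gcomp y ∪ {r, s}`. -/
noncomputable def compW (y : V) : Config E :=
  fun e => if e ∈ within ends (gcomp ends r s ω y ∪ {r, s}) ∧ ω e = false then true else false

/-- The linking set: the vertices of `M₂ ∖ {r, s}` whose component carries `r ~_W s`. -/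
def linkSet : Set V :=
  {x | x ∈ M2 ends r s ω ∧ x ≠ r ∧ x ≠ s ∧ Conn ends (compW ends r s ω x) r s}

variable {ends r s ω}

/-- An open edge of `allM` lies inside `M₂ ∖ {r, s}`. -/
lemma mem_within_of_allM {e : E} (h : allM ends r s ω e = true) :
    e ∈ within ends ((M2 ends r s ω) \ {r, s}) := by
  by_contra h'
  simp only [allM, if_neg h'] at h
  exact absurd h (by decide)

/-- `gconnM` is symmetric. -/
lemma gconnM_symm {x y : V} (h : gconnM ends r s ω x y) : gconnM ends r s ω y x := conn_symm h

/-- `gconnM` is transitive. -/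
lemma gconnM_trans {x y z : V} (h₁ : gconnM ends r s ω x y) (h₂ : gconnM ends r s ω y z) :
    gconnM ends r s ω x z := conn_trans h₁ h₂

/-- Membership in `M₂ ∖ {r, s}`, unfolded. -/
lemma mem_M2_diff_iff {x : V} :
    x ∈ (M2 ends r s ω) \ {r, s} ↔ x ∈ M2 ends r s ω ∧ x ≠ r ∧ x ≠ s := by
  simp only [Set.mem_sdiff, Set.mem_insert_iff, Set.mem_singleton_iff, not_or]

/-- Two vertices of `M₂ ∖ {r, s}` joined by an edge are `G`-connected within it. -/
lemma gconnM_of_edge {e : E} {x y : V} (hends : ends e = s(x, y)) (hx : x ∈ M2 ends r s ω)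
    (hxr : x ≠ r) (hxs : x ≠ s) (hy : y ∈ M2 ends r s ω) (hyr : y ≠ r) (hys : y ≠ s) :
    gconnM ends r s ω x y := by
  refine conn_of_openAdj ⟨e, ?_, hends⟩
  have hw : e ∈ within ends ((M2 ends r s ω) \ {r, s}) :=
    ⟨x, mem_M2_diff_iff.2 ⟨hx, hxr, hxs⟩, y, mem_M2_diff_iff.2 ⟨hy, hyr, hys⟩, hends⟩
  unfold allM
  rw [if_pos hw]

/-- A vertex `G`-connected within `M₂ ∖ {r, s}` to a vertex of it lies in it (or is that vertex). -/
lemma mem_of_gconnM {x y : V} (h : gconnM ends r s ω x y) (hy : y ∈ M2 ends r s ω ∧ y ≠ r ∧ y ≠ s) :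
    x ∈ M2 ends r s ω ∧ x ≠ r ∧ x ≠ s := by
  have key : ∀ v, v ∈ {z | z ∈ M2 ends r s ω ∧ z ≠ r ∧ z ≠ s} → ∀ z,
      (openGraph ends (allM ends r s ω)).Adj v z → z ∈ {z | z ∈ M2 ends r s ω ∧ z ≠ r ∧ z ≠ s} := by
    intro v _ z hvz
    obtain ⟨_, e, he, hends⟩ := openGraph_adj.1 hvz
    obtain ⟨a, ha, b, hb, hab⟩ := mem_within_of_allM he
    rw [hends] at hab
    rcases Sym2.eq_iff.1 hab with ⟨_, hzb⟩ | ⟨_, hza⟩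
    · rw [hzb]; exact mem_M2_diff_iff.1 hb
    · rw [hza]; exact mem_M2_diff_iff.1 ha
  exact mem_of_conn_of_closed key hy (gconnM_symm h)

/-- The component is determined by the class: `G`-connected vertices have the same component. -/
lemma gcomp_eq_of_gconnM {x y : V} (h : gconnM ends r s ω x y) :
    gcomp ends r s ω x = gcomp ends r s ω y := by
  ext z
  exact ⟨fun hz => gconnM_trans hz h, fun hz => gconnM_trans hz (gconnM_symm h)⟩

/-- The carrying configuration is determined by the component. -/
lemma compW_eq_of_gconnM {x y : V} (h : gconnM ends r s ω x y) :
    compW ends r s ω x = compW ends r s ω y := by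
  unfold compW
  rw [gcomp_eq_of_gconnM h]

/-- **The linking set is closed in the `W`-world.** -/
theorem linkSet_wClosed : WClosed ends r s ω (linkSet ends r s ω) where
  subset := fun x hx => ⟨hx.1, hx.2.1, hx.2.2.1⟩
  closed := by
    intro e x y hends hx hy hyr hys
    obtain ⟨hxM, hxr, hxs, hc⟩ := hx
    refine ⟨hy, hyr, hys, ?_⟩
    rw [← compW_eq_of_gconnM (gconnM_of_edge hends hxM hxr hxs hy hyr hys)]
    exact hc

/-- `compW y ≤ compl ω`. -/
lemma compW_le_compl (y : V) : compW ends r s ω y ≤ OneColourSwitch.compl ω := by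
  intro e
  simp only [compW]
  split_ifs with h
  · simp [OneColourSwitch.compl, h.2]
  · exact Bool.false_le _

/-- **The path lemma**: a connection `r ~ s` through `W`-edges (a configuration `τ ≤ compl ω`)
without a direct `r–s` edge has an internal vertex of `M₂ ∖ {r, s}` joined to `r` by `τ` whose
component carries `r ~_W s`. -/
theorem exists_carrier_of_conn (hrs : r ≠ s) (hno : ∀ e, ends e ≠ s(r, s)) {τ : Config E}
    (hτ : τ ≤ OneColourSwitch.compl ω) (hc : Conn ends τ r s) :
    ∃ y, y ∈ M2 ends r s ω ∧ y ≠ r ∧ y ≠ s ∧ Conn ends τ r y ∧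
      Conn ends (compW ends r s ω y) r s := by
  -- the `τ`-edges are `W`-edges, so every vertex `τ`-connected to `r` lies in `M₂`
  have hM : ∀ z, Conn ends τ r z → z ∈ M2 ends r s ω := fun z hz =>
    mem_M2_iff.2 (Or.inl (conn_mono hτ hz))
  set goal := ∃ y, y ∈ M2 ends r s ω ∧ y ≠ r ∧ y ≠ s ∧ Conn ends τ r y ∧
      Conn ends (compW ends r s ω y) r s with hgoal
  have key : ∀ v, v ∈ {z | z = r ∨ goal ∨ (z ∈ M2 ends r s ω ∧ z ≠ r ∧ z ≠ s ∧ Conn ends τ r z ∧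
      Conn ends (compW ends r s ω z) r z)} → ∀ y, (openGraph ends τ).Adj v y →
        y ∈ {z | z = r ∨ goal ∨ (z ∈ M2 ends r s ω ∧ z ≠ r ∧ z ≠ s ∧ Conn ends τ r z ∧
          Conn ends (compW ends r s ω z) r z)} := by
    intro v hv y hvy
    obtain ⟨hne, e, he, hends⟩ := openGraph_adj.1 hvy
    have hw : ω e = false := by
      by_contra h'
      rw [Bool.not_eq_false] at h'
      have := hτ e
      rw [he] at this
      simp only [OneColourSwitch.compl, h', Bool.not_true] at this
      exact Bool.false_ne_true (Bool.le_iff_imp.1 this rfl)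
    have hcompW : ∀ z, e ∈ within ends (gcomp ends r s ω z ∪ {r, s}) →
        compW ends r s ω z e = true := by
      intro z hin
      unfold compW
      rw [if_pos ⟨hin, hw⟩]
    rcases hv with hvr | hg | ⟨hvM, hvr, hvs, hvτ, hvc⟩
    · -- from `r`: the other end is not `s`, hence a vertex of `M₂ ∖ {r, s}`
      have hends' : ends e = s(r, y) := by rw [hends, hvr]
      have hys : y ≠ s := fun h => hno e (by rw [hends', h])
      have hyr : y ≠ r := fun h => hne (hvr.trans h.symm)
      have hτy : Conn ends τ r y := conn_of_openAdj ⟨e, he, hends'⟩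
      have hyM : y ∈ M2 ends r s ω := hM y hτy
      refine Or.inr (Or.inr ⟨hyM, hyr, hys, hτy, conn_of_openAdj ⟨e, hcompW y ?_, hends'⟩⟩)
      exact ⟨r, Or.inr (by simp), y, Or.inl (conn_refl _ _ _), hends'⟩
    · exact Or.inr (Or.inl hg)
    · by_cases hyr : y = r
      · exact Or.inl hyr
      by_cases hys : y = s
      · -- the connection reaches `s`: the component of `v` carries it
        have hends' : ends e = s(v, s) := by rw [hends, hys]
        refine Or.inr (Or.inl ⟨v, hvM, hvr, hvs, hvτ,
          conn_trans hvc (conn_of_openAdj ⟨e, hcompW v ?_, hends'⟩)⟩)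
        exact ⟨v, Or.inl (conn_refl _ _ _), s, Or.inr (by simp), hends'⟩
      · have hτy : Conn ends τ r y := conn_trans hvτ (conn_of_openAdj ⟨e, he, hends⟩)
        have hyM : y ∈ M2 ends r s ω := hM y hτy
        have hg : gconnM ends r s ω v y := gconnM_of_edge hends hvM hvr hvs hyM hyr hys
        refine Or.inr (Or.inr ⟨hyM, hyr, hys, hτy, ?_⟩)
        rw [← compW_eq_of_gconnM hg]
        refine conn_trans hvc (conn_of_openAdj ⟨e, hcompW v ?_, hends⟩)
        exact ⟨v, Or.inl (conn_refl _ _ _), y, Or.inl (gconnM_symm hg), hends⟩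
  rcases mem_of_conn_of_closed key (Or.inl rfl) hc with h | h | ⟨_, _, hss, _, _⟩
  · exact absurd h hrs.symm
  · exact h
  · exact absurd rfl hss

/-- Every vertex of a carrying component lies in the linking set. -/
lemma mem_linkSet_of_mem_gcomp {y z : V} (hy : y ∈ M2 ends r s ω ∧ y ≠ r ∧ y ≠ s)
    (hcy : Conn ends (compW ends r s ω y) r s) (hz : z ∈ gcomp ends r s ω y) :
    z ∈ linkSet ends r s ω := by
  obtain ⟨hzM, hzr, hzs⟩ := mem_of_gconnM hz hy
  refine ⟨hzM, hzr, hzs, ?_⟩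
  rw [compW_eq_of_gconnM hz]
  exact hcy

/-- A connection through the carrying edges of a linking component is a connection through the
`W`-edges touching the linking set (no `r–s` edge). -/
lemma conn_wIn_of_conn_compW (hno : ∀ e, ends e ≠ s(r, s)) {y : V}
    (hy : y ∈ M2 ends r s ω ∧ y ≠ r ∧ y ≠ s) (hcy : Conn ends (compW ends r s ω y) r s)
    {a b : V} (h : Conn ends (compW ends r s ω y) a b) :
    Conn ends (wIn ends (linkSet ends r s ω) ω) a b := by
  have key : ∀ v, v ∈ {z | Conn ends (wIn ends (linkSet ends r s ω) ω) a z} → ∀ z,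
      (openGraph ends (compW ends r s ω y)).Adj v z →
        z ∈ {z | Conn ends (wIn ends (linkSet ends r s ω) ω) a z} := by
    intro v hv z hvz
    obtain ⟨hne, e, he, hends⟩ := openGraph_adj.1 hvz
    have he' : e ∈ within ends (gcomp ends r s ω y ∪ {r, s}) ∧ ω e = false := by
      by_contra h'
      simp only [compW, if_neg h'] at he
      exact absurd he (by decide)
    obtain ⟨⟨c, hc, c', hc', hcc'⟩, hw⟩ := he'
    have ht : e ∈ touches ends (linkSet ends r s ω) := by
      rcases hc with hc | hc
      · exact ⟨c, mem_linkSet_of_mem_gcomp hy hcy hc, c', hcc'⟩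
      · rcases hc' with hc' | hc'
        · exact ⟨c', mem_linkSet_of_mem_gcomp hy hcy hc', c, by rw [hcc', Sym2.eq_swap]⟩
        · exfalso
          simp only [Set.mem_insert_iff, Set.mem_singleton_iff] at hc hc'
          rw [hends, Sym2.eq_iff] at hcc'
          rcases hc with rfl | rfl <;> rcases hc' with rfl | rfl
          · rcases hcc' with ⟨rfl, rfl⟩ | ⟨rfl, rfl⟩ <;> exact hne rfl
          · exact hno e (by rw [hends]; rcases hcc' with ⟨rfl, rfl⟩ | ⟨rfl, rfl⟩ <;>
              first | rfl | exact Sym2.eq_swap)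
          · exact hno e (by rw [hends]; rcases hcc' with ⟨rfl, rfl⟩ | ⟨rfl, rfl⟩ <;>
              first | rfl | exact Sym2.eq_swap)
          · rcases hcc' with ⟨rfl, rfl⟩ | ⟨rfl, rfl⟩ <;> exact hne rfl
    have hwin : wIn ends (linkSet ends r s ω) ω e = true := by
      simp [wIn, ht, hw]
    exact conn_trans hv (conn_of_openAdj ⟨e, hwin, hends⟩)
  exact mem_of_conn_of_closed key (conn_refl _ _ _) h

/-- **The `W`-edges touching the linking set join `r` to `s`** (for `r ~_W s`). -/
theorem conn_wIn_linkSet (hrs : r ≠ s) (hno : ∀ e, ends e ≠ s(r, s))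
    (hc : Conn ends (OneColourSwitch.compl ω) r s) :
    Conn ends (wIn ends (linkSet ends r s ω) ω) r s := by
  obtain ⟨y, hyM, hyr, hys, _, hcy⟩ := exists_carrier_of_conn hrs hno le_rfl hc
  exact conn_wIn_of_conn_compW hno ⟨hyM, hyr, hys⟩ hcy hcy

/-- `wOut ≤ compl ω`. -/
lemma wOut_le_compl (S : Set V) : wOut ends S ω ≤ OneColourSwitch.compl ω := by
  intro e
  simp only [wOut]
  split_ifs
  · exact Bool.false_le _
  · exact le_rfl

/-- **No `W`-path avoiding the linking set joins `r` to `s`.** -/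
theorem not_conn_wOut_linkSet (hrs : r ≠ s) (hno : ∀ e, ends e ≠ s(r, s)) :
    ¬ Conn ends (wOut ends (linkSet ends r s ω) ω) r s := by
  intro hc
  obtain ⟨y, hyM, hyr, hys, hτy, hcy⟩ := exists_carrier_of_conn hrs hno (wOut_le_compl _) hc
  -- `y` is joined to `r` by `wOut`-edges, hence `y ∉ linkSet`; but its component carries `r ~ s`
  have hyL : y ∈ linkSet ends r s ω := ⟨hyM, hyr, hys, hcy⟩
  -- the last `wOut`-edge into `y` touches the linking set: contradiction
  have key : ∀ v, v ∈ {z | z ∉ linkSet ends r s ω} → ∀ z,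
      (openGraph ends (wOut ends (linkSet ends r s ω) ω)).Adj v z →
        z ∈ {z | z ∉ linkSet ends r s ω} := by
    intro v _ z hvz hz
    obtain ⟨_, e, he, hends⟩ := openGraph_adj.1 hvz
    have ht : e ∈ touches ends (linkSet ends r s ω) := mem_touches_of_ends hends (Or.inr hz)
    simp only [wOut, if_pos ht] at he
    exact absurd he (by decide)
  have hrL : r ∉ linkSet ends r s ω := fun h => h.2.1 rfl
  exact mem_of_conn_of_closed key hrL hτy hyL

end Link

end NoPocket

end Summit.Ventures.PercRepro2
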